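import Literature.Geometry.Kaehler.ComplexTorusAnalyticIntersectionCycleProperComponents
import Literature.Geometry.Kaehler.ComplexTorusAnalyticIteratedIntersectionExcessComponents
import HarnessLib

/-!
# Excess components of the intersection `Y₁ ∩ Y₂` of two closed analytic subsets of a complex torus:
# properness means "no excess component"; every component of the intersection cycle is a proper component
# or lies in an excess component

Layer `Literature/Geometry/Kaehler`; lane `lit-hodgefound`, seat p07, programme «INTERSECTION NUMBERS ARE
POINT COUNTS», file 24 — the two-subvariety companion of file 22. Let `Y₁, Y₂ ⊆ X = E/Λ` be closed analytic of
pure dimensions `d₁, d₂` with expected dimension `q + 1 = d₁ + d₂ − g ≥ 1`. By [Chirka1989, §3.5 Prop. 2–3,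
§12.1] every irreducible component of `Y₁ ∩ Y₂` has dimension `≥ q + 1` (tree:
`HasPureCodim.exists_hasPureCodim_of_isIrreducibleComponent_inter`); the PROPER components are those of
dimension `q + 1`, the others are EXCESS components [Fulton1998, §7.1 Def. 7.1]. File 21 constructed the
effective intersection cycle `S` (`[Y₁]_e ∧ [Y₂]_e = sign(e) · cl_e(S)`, `|S| ⊆ Y₁ ∩ Y₂`) containing every proper
component with multiplicity `≥ 1`. This file adds:

* §1 `exists_hasPureDim_of_isIrreducibleComponent_inter` (every component of `Y₁ ∩ Y₂` has pure dimension `m`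
  with `q + 1 ≤ m ≤ g`), **`inter_eq_empty_or_hasPureDim_iff_forall_isIrreducibleComponent`** (PROPERNESS
  CRITERION: `Y₁ ∩ Y₂` is empty or of pure dimension `q + 1` iff it has no excess component),
  `exists_hasPureDim_lt_of_isIrreducibleComponent_inter_of_not_hasPureDim` (excess components have
  dimension `> q + 1`);
* §2 **`exists_effectiveCycle_wedge_analyticCycleClass_eq_forall_mult_ne_zero`** — STRUCTURE OF THE
  INTERSECTION CYCLE: every component `W` of `S` is a proper component of `Y₁ ∩ Y₂` or lies in an excess
  component [Fulton1998, §12.2: "each irreducible component of `⋂ V_i` appears as a distinguished variety"];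
  `exists_effectiveCycle_support_eq_inter_of_forall_isIrreducibleComponent_hasPureDim` — no excess component
  ⇒ `|S| = Y₁ ∩ Y₂` and the components of `S` are exactly the components of `Y₁ ∩ Y₂`, all of multiplicity
  `≥ 1` (the proper case of `ComplexTorusAnalyticIntersectionCycle` §6, with the converse inclusion).

Theorems only; no definitions, no named facts.

## References

* [Chirka1989] E. M. Chirka, *Complex Analytic Sets*, Kluwer 1989, §3.5 Prop. 2–3 (p. 36–37), §5.3 Cor. 1
  (p. 55), §5.4 Thm. (p. 57), §12.1 (p. 136), §16.1 Prop. 1 (p. 206).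
* [Fulton1998] W. Fulton, *Intersection Theory*, 2nd ed., Springer 1998, §7.1 Def. 7.1 and Prop. 7.1 (a),
  §12.2 Cor. 12.2 (a) and Example 12.2.1 (a).
-/

noncomputable section

open scoped Manifold Topology Pointwise
open MeasureTheory Set Function Filter Module
open Literature.LinearAlgebra.Alternating

namespace Literature.Geometry.Kaehler

-- Nested operator-norm instances on `V [⋀^Fin m]→L[ℝ] F`, as in `ComplexTorusAnalyticIntersectionCycle`.
set_option maxSynthPendingDepth 2

namespace ComplexTorus

universe u

variable {ι : Type*} [Fintype ι] [DecidableEq ι] {E : Type u} [NormedAddCommGroup E] [InnerProductSpace ℂ E]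
  [FiniteDimensional ℂ E] [MeasurableSpace E] [BorelSpace E] (Φ : (ι → ℝ) ≃L[ℝ] E) {n : ℕ} (e : Fin n ≃ ι)
  {d₁ d₂ p₁ p₂ q : ℕ}

/-! ### §1 Every component of `Y₁ ∩ Y₂` has dimension `≥ q + 1`; properness means "no excess component" -/

omit [DecidableEq ι] [MeasurableSpace E] [BorelSpace E] in
/-- **Every irreducible component of `Y₁ ∩ Y₂` has pure dimension `m` with `d₁ + d₂ − g ≤ m ≤ g`** ("the
codimension of `A₁ ∩ A₂` at each point does not exceed `codim A₁ + codim A₂`"). The components with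
`m = d₁ + d₂ − g` are the PROPER ones, the others are EXCESS components.
[cite: Chirka1989, §3.5 Prop. 2 (p. 36), §12.1 (p. 136) and §5.4 Thm. (p. 57)] [cite: Fulton1998, §7.1 Def. 7.1] -/
theorem exists_hasPureDim_of_isIrreducibleComponent_inter (hq : q + 1 + finrank ℂ E = d₁ + d₂)
    {Y₁ Y₂ : Set (ComplexTorus Φ)} (hY₁ : HasPureDim 𝓘(ℂ, E) Y₁ d₁) (hY₂ : HasPureDim 𝓘(ℂ, E) Y₂ d₂)
    {C : Set (ComplexTorus Φ)} (hC : IsIrreducibleComponent 𝓘(ℂ, E) (Y₁ ∩ Y₂) C) :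
    ∃ m, q + 1 ≤ m ∧ m ≤ finrank ℂ E ∧ HasPureDim 𝓘(ℂ, E) C m := by
  have h₁ := hY₁.le_finrank
  have h₂ := hY₂.le_finrank
  obtain ⟨c, hc, hCc⟩ :=
    HasPureCodim.exists_hasPureCodim_of_isIrreducibleComponent_inter hY₁.hasPureCodim hY₂.hasPureCodim hC
  have hcg : c ≤ finrank ℂ E := by
    obtain ⟨y, hy⟩ := IsAnalyticSet.nonempty_regularLocus hCc.1 hCc.2.1
    exact (hCc.2.2 y hy).le_finrank
  exact ⟨finrank ℂ E - c, by omega, Nat.sub_le _ _, hCc.hasPureDim hcg⟩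

omit [DecidableEq ι] [MeasurableSpace E] [BorelSpace E] in
/-- **PROPERNESS CRITERION: `Y₁ ∩ Y₂` is proper iff it has no excess component** — it is empty or of pure
dimension `q + 1` iff every irreducible component has pure dimension `q + 1`.
[cite: Chirka1989, §5.4 Thm. (p. 57) and §12.1 (p. 136)] [cite: Fulton1998, §7.1 Def. 7.1] -/
theorem inter_eq_empty_or_hasPureDim_iff_forall_isIrreducibleComponent {Y₁ Y₂ : Set (ComplexTorus Φ)}
    (hY₁ : HasPureDim 𝓘(ℂ, E) Y₁ d₁) (hY₂ : HasPureDim 𝓘(ℂ, E) Y₂ d₂) :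
    (Y₁ ∩ Y₂ = ∅ ∨ HasPureDim 𝓘(ℂ, E) (Y₁ ∩ Y₂) (q + 1)) ↔
      ∀ C, IsIrreducibleComponent 𝓘(ℂ, E) (Y₁ ∩ Y₂) C → HasPureDim 𝓘(ℂ, E) C (q + 1) := by
  constructor
  · rintro (h0 | hI) C hC
    · exfalso
      obtain ⟨z, hz⟩ := hC.nonempty
      have := hC.subset hz
      rw [h0] at this
      exact this
    · exact hC.hasPureDim hI
  · intro h
    by_cases hne : (Y₁ ∩ Y₂).Nonempty
    · exact Or.inr (hasPureDim_of_forall_isIrreducibleComponent Φ (hY₁.isAnalyticSet.inter hY₂.isAnalyticSet)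
        hne h)
    · exact Or.inl (not_nonempty_iff_eq_empty.1 hne)

omit [DecidableEq ι] [MeasurableSpace E] [BorelSpace E] in
/-- **An excess component of `Y₁ ∩ Y₂` has pure dimension `m` with `q + 1 < m ≤ g`.**
[cite: Chirka1989, §3.5 Prop. 2 (p. 36) and §5.4 Thm. (p. 57)] [cite: Fulton1998, §7.1 Def. 7.1] -/
theorem exists_hasPureDim_lt_of_isIrreducibleComponent_inter_of_not_hasPureDim
    (hq : q + 1 + finrank ℂ E = d₁ + d₂) {Y₁ Y₂ : Set (ComplexTorus Φ)} (hY₁ : HasPureDim 𝓘(ℂ, E) Y₁ d₁)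
    (hY₂ : HasPureDim 𝓘(ℂ, E) Y₂ d₂) {C : Set (ComplexTorus Φ)} (hC : IsIrreducibleComponent 𝓘(ℂ, E) (Y₁ ∩ Y₂) C)
    (hnot : ¬ HasPureDim 𝓘(ℂ, E) C (q + 1)) :
    ∃ m, q + 1 < m ∧ m ≤ finrank ℂ E ∧ HasPureDim 𝓘(ℂ, E) C m := by
  obtain ⟨m, hqm, hmg, hCm⟩ := exists_hasPureDim_of_isIrreducibleComponent_inter Φ hq hY₁ hY₂ hC
  refine ⟨m, ?_, hmg, hCm⟩
  rcases hqm.eq_or_lt with h | h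
  · exfalso
    rw [← h] at hCm
    exact hnot hCm
  · exact h

/-! ### §2 Every component of the intersection cycle is a proper component or lies in an excess component -/

/-- **STRUCTURE OF THE INTERSECTION CYCLE.** For closed analytic `Y₁, Y₂` of pure dimensions `d₁, d₂`
(expected dimension `q + 1 ≥ 1`), the effective `(q+1)`-cycle `S` of file 21 (`|S| ⊆ Y₁ ∩ Y₂`,
`[Y₁]_e ∧ [Y₂]_e = sign(e) · cl_e(S)`, every proper component of `Y₁ ∩ Y₂` a component of `S` with multiplicity
`≥ 1`) has EVERY component `W` either a PROPER component of `Y₁ ∩ Y₂`, or contained in an EXCESS component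
`C'` of `Y₁ ∩ Y₂` (of pure dimension `m > q + 1`): `W ⊆ C'` for some component `C'`, of dimension `m ≥ q + 1`,
and `W = C'` if `m = q + 1`. [cite: Fulton1998, §7.1 Prop. 7.1 (a) and §12.2 Cor. 12.2 (a), Example 12.2.1 (a)]
[cite: Chirka1989, §5.3 Cor. 1 (p. 55) and §5.4 Thm. (p. 57)] -/
theorem exists_effectiveCycle_wedge_analyticCycleClass_eq_forall_mult_ne_zero (hk₁ : 2 * d₁ + 2 * p₁ = n)
    (hk₂ : 2 * d₂ + 2 * p₂ = n) (hq : 2 * (q + 1) + 2 * (p₁ + p₂) = n) {Y₁ Y₂ : Set (ComplexTorus Φ)}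
    (hY₁ : HasPureDim 𝓘(ℂ, E) Y₁ d₁) (hY₂ : HasPureDim 𝓘(ℂ, E) Y₂ d₂) :
    ∃ S : HolomorphicChain 𝓘(ℂ, E) (ComplexTorus Φ) (q + 1),
      (∀ W, 0 ≤ S.mult W) ∧ S.support ⊆ Y₁ ∩ Y₂ ∧
        (∀ C, IsIrreducibleComponent 𝓘(ℂ, E) (Y₁ ∩ Y₂) C → HasPureDim 𝓘(ℂ, E) C (q + 1) →
          IsIrreducibleComponent 𝓘(ℂ, E) S.support C ∧ 1 ≤ S.mult C) ∧
        (∀ W, S.mult W ≠ 0 →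
          (IsIrreducibleComponent 𝓘(ℂ, E) (Y₁ ∩ Y₂) W ∧ HasPureDim 𝓘(ℂ, E) W (q + 1)) ∨
          ∃ C' : Set (ComplexTorus Φ), ∃ m, IsIrreducibleComponent 𝓘(ℂ, E) (Y₁ ∩ Y₂) C' ∧
            HasPureDim 𝓘(ℂ, E) C' m ∧ q + 1 < m ∧ W ⊆ C') ∧
        ((analyticCycleClass Φ e hk₁ hY₁).wedge (analyticCycleClass Φ e hk₂ hY₂)).domDomCongr
            (finCongr (by ring : 2 * p₁ + 2 * p₂ = 2 * (p₁ + p₂))) =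
          (orientationSign Φ e : ℂ) • chainCycleClass Φ e hq S := by
  have hng : finrank ℂ E * 2 = n := finrank_complex_mul_two Φ e
  have hq' : q + 1 + finrank ℂ E = d₁ + d₂ := by omega
  obtain ⟨S, hS0, hSs, -, -, hprop, hcl⟩ :=
    exists_effectiveCycle_wedge_analyticCycleClass_eq_forall_one_le_mult Φ e hk₁ hk₂ hq hY₁ hY₂
  refine ⟨S, hS0, hSs, hprop, fun W hW ↦ ?_, hcl⟩
  have hZan : IsAnalyticSet 𝓘(ℂ, E) (Y₁ ∩ Y₂) := hY₁.isAnalyticSet.inter hY₂.isAnalyticSet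
  have hWirr := S.isIrreducibleAnalyticSet_of_mult_ne_zero hW
  have hWdim := S.hasPureDim_of_mult_ne_zero hW
  have hWZ : W ⊆ Y₁ ∩ Y₂ := (HolomorphicChain.subset_support hW).trans hSs
  obtain ⟨C', hC', hWC'⟩ := hWirr.exists_isIrreducibleComponent_superset hZan hWZ
  by_cases hC'dim : HasPureDim 𝓘(ℂ, E) C' (q + 1)
  · left
    have hWC : W = C' :=
      hC'.isIrreducibleAnalyticSet.eq_of_subset_of_hasPureCodim hC'dim.hasPureCodim hWdim.hasPureCodim hWC'
    rw [hWC]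
    exact ⟨hC', hC'dim⟩
  · right
    obtain ⟨m, hm, -, hC'm⟩ :=
      exists_hasPureDim_lt_of_isIrreducibleComponent_inter_of_not_hasPureDim Φ hq' hY₁ hY₂ hC' hC'dim
    exact ⟨C', m, hC', hC'm, hm, hWC'⟩

/-- **No excess component ⇒ the intersection cycle has support `Y₁ ∩ Y₂` and its components are exactly
the components of `Y₁ ∩ Y₂`, all of multiplicity `≥ 1`** (the proper case of
`ComplexTorusAnalyticIntersectionCycle` §6, sharpened by the converse: every component of `S` is a component
of `Y₁ ∩ Y₂`). [cite: Fulton1998, §7.1 Prop. 7.1 (a) and §12.2 Cor. 12.2 (a)] [cite: Chirka1989, §16.1 Prop. 1 (p. 206)] -/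
theorem exists_effectiveCycle_support_eq_inter_of_forall_isIrreducibleComponent_hasPureDim
    (hk₁ : 2 * d₁ + 2 * p₁ = n) (hk₂ : 2 * d₂ + 2 * p₂ = n) (hq : 2 * (q + 1) + 2 * (p₁ + p₂) = n)
    {Y₁ Y₂ : Set (ComplexTorus Φ)} (hY₁ : HasPureDim 𝓘(ℂ, E) Y₁ d₁) (hY₂ : HasPureDim 𝓘(ℂ, E) Y₂ d₂)
    (hproper : ∀ C, IsIrreducibleComponent 𝓘(ℂ, E) (Y₁ ∩ Y₂) C → HasPureDim 𝓘(ℂ, E) C (q + 1)) :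
    ∃ S : HolomorphicChain 𝓘(ℂ, E) (ComplexTorus Φ) (q + 1),
      (∀ W, 0 ≤ S.mult W) ∧ S.support = Y₁ ∩ Y₂ ∧
        (∀ W, S.mult W ≠ 0 ↔ IsIrreducibleComponent 𝓘(ℂ, E) (Y₁ ∩ Y₂) W) ∧
        (∀ C, IsIrreducibleComponent 𝓘(ℂ, E) (Y₁ ∩ Y₂) C → 1 ≤ S.mult C) ∧
        ((analyticCycleClass Φ e hk₁ hY₁).wedge (analyticCycleClass Φ e hk₂ hY₂)).domDomCongr
            (finCongr (by ring : 2 * p₁ + 2 * p₂ = 2 * (p₁ + p₂))) =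
          (orientationSign Φ e : ℂ) • chainCycleClass Φ e hq S := by
  obtain ⟨S, hS0, hSs, hprop, hstruct, hcl⟩ :=
    exists_effectiveCycle_wedge_analyticCycleClass_eq_forall_mult_ne_zero Φ e hk₁ hk₂ hq hY₁ hY₂
  have hZan : IsAnalyticSet 𝓘(ℂ, E) (Y₁ ∩ Y₂) := hY₁.isAnalyticSet.inter hY₂.isAnalyticSet
  have hcomp : ∀ W, S.mult W ≠ 0 → IsIrreducibleComponent 𝓘(ℂ, E) (Y₁ ∩ Y₂) W := by
    intro W hW
    rcases hstruct W hW with ⟨hWc, -⟩ | ⟨C', m, hC', hC'm, hm, -⟩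
    · exact hWc
    · exfalso
      obtain ⟨c₁, hc₁, h₁⟩ := hproper C' hC'
      obtain ⟨c₂, hc₂, h₂⟩ := hC'm
      obtain ⟨y, hy⟩ := IsAnalyticSet.nonempty_regularLocus h₁.1 h₁.2.1
      have := (h₁.2.2 y hy).codim_unique hy.1 (h₂.2.2 y hy)
      omega
  refine ⟨S, hS0, hSs.antisymm fun x hx ↦ ?_, fun W ↦ ⟨hcomp W, fun hW ↦ ?_⟩,
    fun C hC ↦ (hprop C hC (hproper C hC)).2, hcl⟩
  · obtain ⟨C, hC, hxC⟩ := (isIrreducibleAnalyticSet_singleton (I := 𝓘(ℂ, E)) x)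
      |>.exists_isIrreducibleComponent_superset hZan (singleton_subset_iff.2 hx)
    exact (hprop C hC (hproper C hC)).1.subset (singleton_subset_iff.1 hxC)
  · have h1 := (hprop W hW (hproper W hW)).2
    omega

/-- **Proper intersection, component form**: if `Y₁ ∩ Y₂` has pure dimension `q + 1`, the intersection cycle
has support `Y₁ ∩ Y₂` and components exactly the irreducible components of `Y₁ ∩ Y₂`, each with multiplicity
`≥ 1`. [cite: Fulton1998, §7.1 Prop. 7.1 (a), §8.2 and §12.2 Cor. 12.2 (a)] [cite: Chirka1989, §16.1 Prop. 1 (p. 206)] -/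
theorem exists_effectiveCycle_support_eq_inter_of_hasPureDim (hk₁ : 2 * d₁ + 2 * p₁ = n)
    (hk₂ : 2 * d₂ + 2 * p₂ = n) (hq : 2 * (q + 1) + 2 * (p₁ + p₂) = n) {Y₁ Y₂ : Set (ComplexTorus Φ)}
    (hY₁ : HasPureDim 𝓘(ℂ, E) Y₁ d₁) (hY₂ : HasPureDim 𝓘(ℂ, E) Y₂ d₂)
    (hI : HasPureDim 𝓘(ℂ, E) (Y₁ ∩ Y₂) (q + 1)) :
    ∃ S : HolomorphicChain 𝓘(ℂ, E) (ComplexTorus Φ) (q + 1),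
      (∀ W, 0 ≤ S.mult W) ∧ S.support = Y₁ ∩ Y₂ ∧
        (∀ W, S.mult W ≠ 0 ↔ IsIrreducibleComponent 𝓘(ℂ, E) (Y₁ ∩ Y₂) W) ∧
        (∀ C, IsIrreducibleComponent 𝓘(ℂ, E) (Y₁ ∩ Y₂) C → 1 ≤ S.mult C) ∧
        ((analyticCycleClass Φ e hk₁ hY₁).wedge (analyticCycleClass Φ e hk₂ hY₂)).domDomCongr
            (finCongr (by ring : 2 * p₁ + 2 * p₂ = 2 * (p₁ + p₂))) =
          (orientationSign Φ e : ℂ) • chainCycleClass Φ e hq S :=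
  exists_effectiveCycle_support_eq_inter_of_forall_isIrreducibleComponent_hasPureDim Φ e hk₁ hk₂ hq hY₁ hY₂
    fun _ hC ↦ hC.hasPureDim hI

end ComplexTorus

end Literature.Geometry.Kaehler

end
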